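import Mathlib.Data.Nat.Prime.Basic
import Mathlib.Data.Nat.ModEq
import Mathlib.Combinatorics.Pigeonhole
import Mathlib.Data.Real.Basic
import Mathlib.Algebra.Order.Field.Basic
import Mathlib.Algebra.BigOperators.Ring.Finset
import Mathlib.Tactic
import HarnessLib

/-!
# The greedy sieve with `n`-th power residue classes (McCurley's covering step)

Topic `Literature/NumberTheory/Sieve`. Everything in this file is PROVED (Mathlib only).

In the Rankin-type construction of K. S. McCurley, *The smallest prime value of `xⁿ + a`*,
Can. J. Math. 38 (1986), §§3–4, an interval `0 ≤ m ≤ u` is covered by congruences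
`mⁿ + a ≡ 0 (mod p)`: choosing `a (mod p)` amounts to choosing ONE value `v` of the power map
`x ↦ xⁿ (mod p)` and removing every `m` with `mⁿ ≡ v`. "Since the function `h(x) = xⁿ` takes on
only `1 + (p − 1)/(p − 1, n)` values modulo `p`, we have `mⁿ + a ≡ 0 (mod p)` for at least
`N/(1 + (p − 1)/(p − 1, n))` of the numbers counted in `N`. Hence
`N_k ≤ N₀ ∏_{p ≤ p_k} (p − 1)/(p − 1 + (p − 1, n))`" [cite: McCurley1986SmallestPrimeValue, §3 (pp. 931–932)].

We prove this greedy step with `(p − 1, n)` replaced by the number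
`g_p(n) = #{x mod p : xⁿ ≡ 1 (mod p)}` of `n`-th roots of unity modulo `p` (which IS
`(p − 1, n)`, a fact we do not need): writing `V_p(n) = #{xⁿ mod p}` for the number of values,

* `card_powValues_sub_one_mul_card_powRoots_le` : `(V_p(n) − 1) · g_p(n) ≤ p − 1` (each non-zero
  value is taken on a whole coset of the `n`-th roots of unity);
* `exists_powClass_card_filter_le` : for a finite `R ⊆ ℕ` some residue `c` leaves at most
  `#R · (p − 1)/(p − 1 + g_p(n))` elements `m ∈ R` with `p ∤ mⁿ + c` (pigeonhole over the values);
* `exists_powClasses_card_filter_le` : iterating over a finite set of primes `P`, some choice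
  `c : ℕ → ℕ` leaves at most `#R · ∏_{p ∈ P} (p − 1)/(p − 1 + g_p(n))` elements `m ∈ R` with
  `p ∤ mⁿ + c p` for all `p ∈ P` — McCurley's displayed inequality.

All counts are over `Finset.range p` with `xⁿ % p`, so that the statements are total in `p`
(no `ZMod p` instances); `n ≥ 1` throughout (for `n = 0` the value set is `{1}`).

## References

* K. S. McCurley, *The smallest prime value of `xⁿ + a`*, Can. J. Math. 38 (1986) 925–936, §3.
  [McCurley1986SmallestPrimeValue]
-/

open Finset

namespace Literature.NumberTheory.Sieve

/-! ### The power map modulo a prime -/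

/-- `mⁿ % p` only depends on `m % p`, so the values of `m ↦ mⁿ % p` on all of `ℕ` are the values
on `range p`. [folklore] -/
theorem pow_mod_mem_powValues {p : ℕ} (hp : 0 < p) (n m : ℕ) :
    m ^ n % p ∈ (range p).image fun x => x ^ n % p :=
  mem_image.2 ⟨m % p, mem_range.2 (Nat.mod_lt m hp), by rw [← Nat.pow_mod]⟩

/-- `1` is an `n`-th root of unity modulo `p ≥ 2`, so `g_p(n) ≥ 1`. [folklore] -/
theorem one_le_card_powRoots {p : ℕ} (hp : 2 ≤ p) (n : ℕ) :
    1 ≤ #((range p).filter fun x => x ^ n % p = 1) := by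
  refine card_pos.2 ⟨1, mem_filter.2 ⟨mem_range.2 (by omega), ?_⟩⟩
  rw [one_pow, Nat.mod_eq_of_lt (by omega)]

/-- `0 = 0ⁿ % p` is a value (`n ≥ 1`), so `V_p(n) ≥ 1`; more precisely `0 ∈ {xⁿ % p}`.
[folklore] -/
theorem zero_mem_powValues {p n : ℕ} (hp : 0 < p) (hn : 1 ≤ n) :
    0 ∈ (range p).image fun x => x ^ n % p :=
  mem_image.2 ⟨0, mem_range.2 hp, by rw [zero_pow (by omega), Nat.zero_mod]⟩

/-- **Values versus roots of unity of the power map.** For `p` prime and `n ≥ 1`,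
`(V_p(n) − 1) · g_p(n) ≤ p − 1`, where `V_p(n) = #{xⁿ % p : x < p}` and
`g_p(n) = #{x < p : xⁿ % p = 1}`: the `p − 1` non-zero residues are partitioned according to the
(non-zero) value of `xⁿ`, and the fibre above a value `x₀ⁿ` contains the `g_p(n)` distinct residues
`x₀ ζ`, `ζⁿ ≡ 1`. (In fact equality holds and `g_p(n) = (p − 1, n)`; McCurley: "`h(x) = xⁿ` takes
on only `1 + (p − 1)/(p − 1, n)` values modulo `p`".)
[cite: McCurley1986SmallestPrimeValue, §3 (p. 931)] -/
theorem card_powValues_sub_one_mul_card_powRoots_le {p n : ℕ} (hp : p.Prime) (hn : 1 ≤ n) :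
    (#((range p).image fun x => x ^ n % p) - 1) * #((range p).filter fun x => x ^ n % p = 1) ≤
      p - 1 := by
  have hp2 := hp.two_le
  have hp0 : 0 < p := hp.pos
  set f : ℕ → ℕ := fun x => x ^ n % p with hf
  set T := (range p).image f with hT
  set K := (range p).filter fun x => x ^ n % p = 1 with hK
  set R₀ := (range p).filter fun x => x ≠ 0 with hR₀
  -- the non-zero residues and their values
  have hR₀card : #R₀ = p - 1 := by
    have h1 : R₀ = (range p).erase 0 := by
      ext x; simp [hR₀, mem_erase, and_comm]
    rw [h1, card_erase_of_mem (mem_range.2 hp0), card_range]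
  have hf0 : ∀ x ∈ range p, f x = 0 → x = 0 := by
    intro x hx hfx
    have hdvd : p ∣ x ^ n := Nat.dvd_of_mod_eq_zero hfx
    exact Nat.eq_zero_of_dvd_of_lt (hp.dvd_of_dvd_pow hdvd) (mem_range.1 hx)
  have hmaps : ∀ x ∈ R₀, f x ∈ T.erase 0 := by
    intro x hx
    rw [hR₀, mem_filter] at hx
    exact mem_erase.2 ⟨fun h => hx.2 (hf0 x hx.1 h), mem_image_of_mem f hx.1⟩
  -- each fibre above a non-zero value has at least `#K` elements
  have hfib : ∀ v ∈ T.erase 0, #K ≤ #(R₀.filter fun x => f x = v) := by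
    intro v hv
    obtain ⟨hv0, hvT⟩ := mem_erase.1 hv
    obtain ⟨x₀, hx₀, rfl⟩ := mem_image.1 hvT
    have hx₀0 : x₀ ≠ 0 := fun h => hv0 (by rw [h, hf]; simp [zero_pow (by omega : n ≠ 0)])
    have hx₀p : ¬ p ∣ x₀ := fun h => hx₀0 (Nat.eq_zero_of_dvd_of_lt h (mem_range.1 hx₀))
    have hcop : Nat.Coprime p x₀ := (Nat.Prime.coprime_iff_not_dvd hp).2 hx₀p
    -- the injection `ζ ↦ x₀ ζ % p`
    refine card_le_card_of_injOn (fun ζ => x₀ * ζ % p) (fun ζ hζ => ?_) ?_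
    · rw [hK, mem_coe, mem_filter] at hζ
      obtain ⟨hζp, hζ1⟩ := hζ
      have hζ0 : ¬ p ∣ ζ := by
        intro h
        have h' : ζ ^ n % p = 0 := Nat.mod_eq_zero_of_dvd (dvd_pow h (by omega : n ≠ 0))
        omega
      rw [mem_coe, mem_filter, hR₀, mem_filter]
      refine ⟨⟨mem_range.2 (Nat.mod_lt _ hp0), fun h => ?_⟩, ?_⟩
      · have : p ∣ x₀ * ζ := Nat.dvd_of_mod_eq_zero h
        rcases (Nat.Prime.dvd_mul hp).1 this with h' | h'
        · exact hx₀p h'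
        · exact hζ0 h'
      · show (x₀ * ζ % p) ^ n % p = x₀ ^ n % p
        rw [← Nat.pow_mod, mul_pow, Nat.mul_mod, hζ1, mul_one, Nat.mod_mod]
    · intro ζ hζ ζ' hζ' h
      rw [hK, mem_coe, mem_filter, mem_range] at hζ hζ'
      have hmod : x₀ * ζ ≡ x₀ * ζ' [MOD p] := h
      have h2 : ζ % p = ζ' % p := Nat.ModEq.cancel_left_of_coprime hcop hmod
      rwa [Nat.mod_eq_of_lt hζ.1, Nat.mod_eq_of_lt hζ'.1] at h2
  -- sum over the fibres
  have hsum : #R₀ = ∑ v ∈ T.erase 0, #(R₀.filter fun x => f x = v) :=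
    card_eq_sum_card_fiberwise hmaps
  have hTcard : #(T.erase 0) = #T - 1 := card_erase_of_mem (zero_mem_powValues hp0 hn)
  calc (#T - 1) * #K = ∑ _v ∈ T.erase 0, #K := by rw [sum_const, smul_eq_mul, hTcard]
    _ ≤ ∑ v ∈ T.erase 0, #(R₀.filter fun x => f x = v) := sum_le_sum hfib
    _ = p - 1 := by rw [← hsum, hR₀card]

/-- The real-number form used in the sieve: `1 − 1/V_p(n) ≤ (p − 1)/(p − 1 + g_p(n))`.
[cite: McCurley1986SmallestPrimeValue, §3 (pp. 931–932)] -/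
theorem one_sub_inv_card_powValues_le {p n : ℕ} (hp : p.Prime) (hn : 1 ≤ n) :
    1 - (#((range p).image fun x => x ^ n % p) : ℝ)⁻¹ ≤
      ((p : ℝ) - 1) / ((p : ℝ) - 1 + #((range p).filter fun x => x ^ n % p = 1)) := by
  have hp2 := hp.two_le
  set V := #((range p).image fun x => x ^ n % p) with hV
  set g := #((range p).filter fun x => x ^ n % p = 1) with hg
  have hV1 : 1 ≤ V := card_pos.2 ⟨0, zero_mem_powValues hp.pos hn⟩
  have hg1 : 1 ≤ g := one_le_card_powRoots hp2 n
  have hkey := card_powValues_sub_one_mul_card_powRoots_le hp hn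
  rw [← hV, ← hg] at hkey
  -- cast to `ℝ`
  have hkeyR : ((V : ℝ) - 1) * g ≤ (p : ℝ) - 1 := by
    have h1 : (((V - 1) * g : ℕ) : ℝ) ≤ ((p - 1 : ℕ) : ℝ) := by exact_mod_cast hkey
    rwa [Nat.cast_mul, Nat.cast_sub hV1, Nat.cast_sub (by omega : 1 ≤ p), Nat.cast_one] at h1
  have hVpos : (0 : ℝ) < V := by exact_mod_cast hV1
  have hgpos : (0 : ℝ) < g := by exact_mod_cast hg1
  have hp1 : (1 : ℝ) ≤ p := by exact_mod_cast hp.one_le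
  rw [show 1 - (V : ℝ)⁻¹ = ((V : ℝ) - 1) / V by field_simp, div_le_div_iff₀ hVpos (by linarith)]
  nlinarith

/-! ### One prime: pigeonhole over the values of `mⁿ (mod p)` -/

/-- **Pigeonhole over the values of the power map.** For a finite `R ⊆ ℕ`, a prime `p` and
`n ≥ 1`, some value `v` of `x ↦ xⁿ % p` is taken by at least `#R / V_p(n)` elements of `R`.
[folklore] -/
theorem exists_powValue_card_ge (R : Finset ℕ) {p n : ℕ} (hp : p.Prime) (hn : 1 ≤ n) :
    ∃ v ∈ (range p).image (fun x => x ^ n % p),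
      (#R : ℝ) / #((range p).image fun x => x ^ n % p) ≤ #(R.filter fun m => m ^ n % p = v) := by
  classical
  set T := (range p).image fun x => x ^ n % p with hT
  have hmaps : ∀ m ∈ R, m ^ n % p ∈ T := fun m _ => pow_mod_mem_powValues hp.pos n m
  have hne : T.Nonempty := ⟨0, zero_mem_powValues hp.pos hn⟩
  have hTpos : (0 : ℝ) < #T := by exact_mod_cast card_pos.2 hne
  have hb : (#T) • ((#R : ℝ) / #T) ≤ #R := by
    rw [nsmul_eq_mul, mul_div_cancel₀ _ hTpos.ne']
  obtain ⟨v, hv, hle⟩ := exists_le_card_fiber_of_nsmul_le_card_of_maps_to hmaps hne hb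
  exact ⟨v, hv, hle⟩

/-- **One greedy step.** For a finite `R ⊆ ℕ`, a prime `p` and `n ≥ 1` there is `c` such that the
`m ∈ R` with `p ∤ mⁿ + c` number at most `#R · (p − 1)/(p − 1 + g_p(n))`: take `c ≡ −v` for the
most popular value `v` of `mⁿ (mod p)` on `R`.
[cite: McCurley1986SmallestPrimeValue, §3 (pp. 931–932)] -/
theorem exists_powClass_card_filter_le (R : Finset ℕ) {p n : ℕ} (hp : p.Prime) (hn : 1 ≤ n) :
    ∃ c : ℕ, (#(R.filter fun m => ¬ p ∣ m ^ n + c) : ℝ) ≤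
      #R * (((p : ℝ) - 1) / ((p : ℝ) - 1 + #((range p).filter fun x => x ^ n % p = 1))) := by
  obtain ⟨v, hv, hle⟩ := exists_powValue_card_ge R hp hn
  have hvp : v < p := by
    obtain ⟨x, -, rfl⟩ := mem_image.1 hv
    exact Nat.mod_lt _ hp.pos
  refine ⟨p - v, ?_⟩
  -- the survivors avoid the fibre of `v`
  have hsub : (R.filter fun m => ¬ p ∣ m ^ n + (p - v)) ⊆ R.filter fun m => ¬ m ^ n % p = v := by
    intro m hm
    rw [mem_filter] at hm ⊢
    refine ⟨hm.1, fun hmv => hm.2 ?_⟩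
    have h1 : p ∣ m ^ n - v := hmv ▸ Nat.dvd_sub_mod (m ^ n)
    have h2 : v ≤ m ^ n := hmv ▸ Nat.mod_le _ _
    have h3 : m ^ n + (p - v) = (m ^ n - v) + p := by omega
    rw [h3]
    exact dvd_add h1 dvd_rfl
  have hsplit := card_filter_add_card_filter_not (s := R) (fun m => m ^ n % p = v)
  have hcard : (#(R.filter fun m => ¬ m ^ n % p = v) : ℝ) =
      #R - #(R.filter fun m => m ^ n % p = v) := by
    rw [eq_sub_iff_add_eq, add_comm]
    exact_mod_cast hsplit
  have hfac := one_sub_inv_card_powValues_le hp hn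
  have hR0 : (0 : ℝ) ≤ #R := Nat.cast_nonneg _
  calc (#(R.filter fun m => ¬ p ∣ m ^ n + (p - v)) : ℝ)
      ≤ #(R.filter fun m => ¬ m ^ n % p = v) := by exact_mod_cast card_le_card hsub
    _ = #R - #(R.filter fun m => m ^ n % p = v) := hcard
    _ ≤ #R - #R / #((range p).image fun x => x ^ n % p) := by linarith
    _ = #R * (1 - (#((range p).image fun x => x ^ n % p) : ℝ)⁻¹) := by ring
    _ ≤ #R * (((p : ℝ) - 1) / ((p : ℝ) - 1 + #((range p).filter fun x => x ^ n % p = 1))) :=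
        mul_le_mul_of_nonneg_left hfac hR0

/-! ### The greedy sieve over a set of primes -/

/-- The factor `(p − 1)/(p − 1 + g_p(n))` lies in `[0, 1]`. [folklore] -/
theorem powClassFactor_nonneg_le_one {p : ℕ} (hp : p.Prime) (n : ℕ) :
    0 ≤ ((p : ℝ) - 1) / ((p : ℝ) - 1 + #((range p).filter fun x => x ^ n % p = 1)) ∧
      ((p : ℝ) - 1) / ((p : ℝ) - 1 + #((range p).filter fun x => x ^ n % p = 1)) ≤ 1 := by
  have hp1 : (1 : ℝ) ≤ p := by exact_mod_cast hp.one_le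
  have hg : (0 : ℝ) ≤ #((range p).filter fun x => x ^ n % p = 1) := Nat.cast_nonneg _
  refine ⟨div_nonneg (by linarith) (by linarith), ?_⟩
  rcases eq_or_lt_of_le (show (0 : ℝ) ≤ (p : ℝ) - 1 + #((range p).filter fun x => x ^ n % p = 1)
    by linarith) with h | h
  · rw [← h, div_zero]; exact zero_le_one
  · rw [div_le_one h]; linarith

/-- **McCurley's greedy sieve with power classes.** For a finite `R ⊆ ℕ`, a finite set `P` of
primes and `n ≥ 1` there is a choice `c : ℕ → ℕ` of one residue per prime such that the `m ∈ R`
satisfying NO congruence `mⁿ + c p ≡ 0 (mod p)`, `p ∈ P`, number at most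
`#R · ∏_{p ∈ P} (p − 1)/(p − 1 + g_p(n))` ("`N_k ≤ N₀ ∏_{p ≤ p_k} (p − 1)/(p − 1 + (p − 1, n))`").
[cite: McCurley1986SmallestPrimeValue, §3 (p. 932)] -/
theorem exists_powClasses_card_filter_le (R : Finset ℕ) (P : Finset ℕ) (hP : ∀ p ∈ P, p.Prime)
    {n : ℕ} (hn : 1 ≤ n) :
    ∃ c : ℕ → ℕ, (#(R.filter fun m => ∀ p ∈ P, ¬ p ∣ m ^ n + c p) : ℝ) ≤
      #R * ∏ p ∈ P, ((p : ℝ) - 1) / ((p : ℝ) - 1 + #((range p).filter fun x => x ^ n % p = 1)) := by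
  classical
  induction P using Finset.induction_on with
  | empty => exact ⟨fun _ => 0, by simp⟩
  | insert q P hq ih =>
    obtain ⟨c, hc⟩ := ih fun p hp => hP p (mem_insert_of_mem hp)
    have hqP : q.Prime := hP q (mem_insert_self q P)
    set T := R.filter fun m => ∀ p ∈ P, ¬ p ∣ m ^ n + c p with hT
    obtain ⟨a, ha⟩ := exists_powClass_card_filter_le T hqP hn
    refine ⟨Function.update c q a, ?_⟩
    have hset : (R.filter fun m => ∀ p ∈ insert q P, ¬ p ∣ m ^ n + Function.update c q a p) =
        T.filter fun m => ¬ q ∣ m ^ n + a := by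
      ext m
      simp only [hT, mem_filter, forall_mem_insert, Function.update_self]
      constructor
      · rintro ⟨hm, h1, h2⟩
        refine ⟨⟨hm, fun p hp => ?_⟩, h1⟩
        have := h2 p hp
        rwa [Function.update_of_ne (ne_of_mem_of_not_mem hp hq)] at this
      · rintro ⟨⟨hm, h2⟩, h1⟩
        refine ⟨hm, h1, fun p hp => ?_⟩
        rw [Function.update_of_ne (ne_of_mem_of_not_mem hp hq)]
        exact h2 p hp
    rw [hset, prod_insert hq]
    obtain ⟨hf0, -⟩ := powClassFactor_nonneg_le_one hqP n
    calc (#(T.filter fun m => ¬ q ∣ m ^ n + a) : ℝ)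
        ≤ #T * (((q : ℝ) - 1) / ((q : ℝ) - 1 + #((range q).filter fun x => x ^ n % q = 1))) := ha
      _ ≤ (#R * ∏ p ∈ P, ((p : ℝ) - 1) / ((p : ℝ) - 1 + #((range p).filter fun x => x ^ n % p = 1))) *
            (((q : ℝ) - 1) / ((q : ℝ) - 1 + #((range q).filter fun x => x ^ n % q = 1))) :=
          mul_le_mul_of_nonneg_right hc hf0
      _ = _ := by ring

/-- **One survivor per modulus.** If a finite `R ⊆ ℕ` has at most as many elements as a finite
set `P` of positive moduli, one class per modulus kills `R`: assign to each `m ∈ R` its own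
`p ∈ P` and take `c p ≡ −mⁿ (mod p)`. [folklore] -/
theorem exists_powClasses_of_card_le (R : Finset ℕ) (P : Finset ℕ) (hP : ∀ p ∈ P, 0 < p)
    (n : ℕ) (h : #R ≤ #P) :
    ∃ c : ℕ → ℕ, ∀ m ∈ R, ∃ p ∈ P, p ∣ m ^ n + c p := by
  classical
  induction R using Finset.induction_on generalizing P with
  | empty => exact ⟨fun _ => 0, by simp⟩
  | insert m R hm ih =>
    rw [card_insert_of_notMem hm] at h
    obtain ⟨p₀, hp₀⟩ : P.Nonempty := card_pos.1 (by omega)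
    obtain ⟨c, hc⟩ := ih (P.erase p₀) (fun p hp => hP p (mem_of_mem_erase hp))
      (by rw [card_erase_of_mem hp₀]; omega)
    refine ⟨Function.update c p₀ (p₀ - m ^ n % p₀), ?_⟩
    intro j hj
    rcases mem_insert.1 hj with rfl | hj
    · refine ⟨p₀, hp₀, ?_⟩
      rw [Function.update_self]
      have h1 : p₀ ∣ j ^ n - j ^ n % p₀ := Nat.dvd_sub_mod (j ^ n)
      have h2 : j ^ n % p₀ ≤ j ^ n := Nat.mod_le _ _
      have h3 : j ^ n % p₀ < p₀ := Nat.mod_lt _ (hP p₀ hp₀)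
      have h4 : j ^ n + (p₀ - j ^ n % p₀) = (j ^ n - j ^ n % p₀) + p₀ := by omega
      rw [h4]
      exact dvd_add h1 dvd_rfl
    · obtain ⟨p, hp, hdvd⟩ := hc j hj
      refine ⟨p, mem_of_mem_erase hp, ?_⟩
      rwa [Function.update_of_ne (ne_of_mem_erase hp)]

end Literature.NumberTheory.Sieve
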